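import Literature.NumberTheory.GaloisRepresentations.WeilDeligneRepProofs
import HarnessLib

/-!
# Stub `stub_eulerFactor_eq_of_isEquivalent` for line `Sketch_18745_r1_k1` (crux stmt-Langlands-18745)

**The Euler factor of a Weil–Deligne representation is an isomorphism invariant.**  An
isomorphism `e : (V, ρ, N) ≅ (V', ρ', N')` of Weil–Deligne representations (possibly on different
spaces) intertwines `ρ, ρ'` and `N, N'`, hence maps `(ker N)^{I_F}` onto `(ker N')^{I_F}`
(`eulerIso_map_inertiaInvariantsKerN_eq`); the induced linear equivalence
`(ker N)^{I_F} ≃ (ker N')^{I_F}` (Mathlib `LinearEquiv.ofSubmodules`) conjugates the restricted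
Frobenii (`eulerIso_conj_restrictInertiaInvariantsKerN`), and the Euler factor
`det(1 - T · ρ(Φ) | (ker N)^{I_F}) = (charpoly ρ(Φ)|).reverse`
(`WeilDeligneRep.eulerFactor_eq_reverse_charpoly`) is a conjugation invariant
(Mathlib `LinearEquiv.charpoly_conj`).

Ref: J. Tate, *Number theoretic background* (Corvallis 1979), (4.1.6).
-/

set_option linter.dupNamespace false -- `Summit.Langlands.Langlands` is the mandated namespace

noncomputable section

open Module Literature.NumberTheory.GaloisRepresentations

namespace Summit.Langlands.Langlands.Theorems.ReciprocityRigidity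

variable {F : Type} [Field F] [ValuativeRel F] [TopologicalSpace F] [IsNonarchimedeanLocalField F]

section Helpers

variable {V : Type*} [AddCommGroup V] [Module ℂ V] {V' : Type*} [AddCommGroup V'] [Module ℂ V']
  {r : WeilDeligneRep F ℂ V} {r' : WeilDeligneRep F ℂ V'}

/-- An isomorphism of Weil–Deligne representations intertwines the Weil group actions
(pointwise form). [folklore] -/
theorem eulerIso_ρ_apply (e : r.Equiv r') (w : WeilGroup F) (v : V) :
    e.toLinearEquiv (r.ρ w v) = r'.ρ w (e.toLinearEquiv v) :=
  congr($(e.isIntertwining' w) v)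

/-- An isomorphism of Weil–Deligne representations intertwines the monodromy operators
(pointwise form). [folklore] -/
theorem eulerIso_N_apply (e : r.Equiv r') (v : V) :
    e.toLinearEquiv (r.N v) = r'.N (e.toLinearEquiv v) :=
  congr($(e.comm_N) v)

/-- An isomorphism of Weil–Deligne representations maps `(ker N)^{I_F}` into `(ker N')^{I_F}`.
[cite: TateCorvallis1979, (4.1.6)] -/
theorem eulerIso_apply_mem_inertiaInvariantsKerN (e : r.Equiv r') {v : V}
    (hv : v ∈ r.inertiaInvariantsKerN) : e.toLinearEquiv v ∈ r'.inertiaInvariantsKerN := by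
  rw [WeilDeligneRep.mem_inertiaInvariantsKerN_iff] at hv ⊢
  refine ⟨?_, fun u hu => ?_⟩
  · rw [← eulerIso_N_apply, hv.1, map_zero]
  · rw [← eulerIso_ρ_apply, hv.2 u hu]

/-- An isomorphism of Weil–Deligne representations maps `(ker N)^{I_F}` onto `(ker N')^{I_F}`.
[cite: TateCorvallis1979, (4.1.6)] -/
theorem eulerIso_map_inertiaInvariantsKerN_eq (e : r.Equiv r') :
    r.inertiaInvariantsKerN.map (e.toLinearEquiv : V →ₗ[ℂ] V') = r'.inertiaInvariantsKerN := by
  apply le_antisymm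
  · rintro _ ⟨v, hv, rfl⟩
    exact eulerIso_apply_mem_inertiaInvariantsKerN e hv
  · intro v' hv'
    exact ⟨e.toLinearEquiv.symm v', eulerIso_apply_mem_inertiaInvariantsKerN e.symm hv',
      e.toLinearEquiv.apply_symm_apply v'⟩

/-- The linear equivalence `(ker N)^{I_F} ≃ (ker N')^{I_F}` induced by an isomorphism of
Weil–Deligne representations conjugates the restricted actions of every `w ∈ W_F`.
[cite: TateCorvallis1979, (4.1.6)] -/
theorem eulerIso_conj_restrictInertiaInvariantsKerN (hn : absInertia_normal F) (e : r.Equiv r')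
    (w : WeilGroup F) :
    (e.toLinearEquiv.ofSubmodules _ _ (eulerIso_map_inertiaInvariantsKerN_eq e)).conj
        (r.restrictInertiaInvariantsKerN hn w) = r'.restrictInertiaInvariantsKerN hn w := by
  ext v
  simp only [LinearEquiv.conj_apply_apply, LinearEquiv.ofSubmodules_apply,
    WeilDeligneRep.coe_restrictInertiaInvariantsKerN_apply, LinearEquiv.ofSubmodules_symm_apply,
    eulerIso_ρ_apply, LinearEquiv.apply_symm_apply]

end Helpers

/-- **Stub W2-A: the Euler factor is an isomorphism invariant.**  An isomorphism of
Weil–Deligne representations identifies the spaces `(ker N)^{I_F}` and conjugates the restricted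
geometric Frobenii (`eulerIso_conj_restrictInertiaInvariantsKerN`); the Euler factor is the
reversed characteristic polynomial of the restricted Frobenius
(`WeilDeligneRep.eulerFactor_eq_reverse_charpoly`), and `charpoly` is conjugation invariant
(`LinearEquiv.charpoly_conj`). [cite: TateCorvallis1979, (4.1.6)] -/
theorem stub_eulerFactor_eq_of_isEquivalent (hn : absInertia_normal F)
    (hex : @exists_isFrobPow F _ _ _ _)
    {V : Type*} [AddCommGroup V] [Module ℂ V] [FiniteDimensional ℂ V]
    {V' : Type*} [AddCommGroup V'] [Module ℂ V'] [FiniteDimensional ℂ V']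
    {r : WeilDeligneRep F ℂ V} {r' : WeilDeligneRep F ℂ V'} (h : r.IsEquivalent r') :
    r.eulerFactor hn hex = r'.eulerFactor hn hex := by
  obtain ⟨e⟩ := h
  rw [r.eulerFactor_eq_reverse_charpoly hn hex (WeilDeligneRep.deg_geomFrob' hex),
    r'.eulerFactor_eq_reverse_charpoly hn hex (WeilDeligneRep.deg_geomFrob' hex),
    ← eulerIso_conj_restrictInertiaInvariantsKerN hn e (WeilDeligneRep.geomFrob F hex),
    LinearEquiv.charpoly_conj]

end Summit.Langlands.Langlands.Theorems.ReciprocityRigidity
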